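import Summits.HodgeConjecture.CorCM.CyclicCMFieldsAllTypes
import Summits.HodgeConjecture.CorCM.AbelianCMFieldsOddPartClassification
import Literature.NumberTheory.ComplexMultiplication.CMGaloisSubfield
import Mathlib.FieldTheory.Galois.Abelian
import HarnessLib

/-!
# Abelian CM fields: EVERY abelian variety with complex multiplication by the field is stably nondegenerate iff the
# field is GOOD — the all-types upgrade of the complete abelian classification

COR-CM (cell `pub-hodgecm2`), binder seat b04 (gen 21), count-neutral claim ABELIAN-ALLTYPES (companion of the
DICYCLIC, CYCLIC and SMALL-DEGREE all-types files).  KERNEL ONLY: theorems; no definition, no named fact, no `sorry`.  `HC_CM` is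
neither used nor claimed: the Hodge conjecture for a NAMED CLASS of abelian varieties, UNCONDITIONALLY.

Gens 15–18 (`AbelianTwoPowerClassification`, `AbelianCMFieldsOddPartClassification`): for an ABELIAN CM field `K`
(Galois over `ℚ` with commutative group) of degree `2^{a+1} m`, `m` odd, every SIMPLE abelian variety with CM by `K` is
nondegenerate ⟺ GOOD(K): (`m = 1` ∧ ((α) complex conjugation lies in a cyclic subgroup of index `≤ 2` ∨ (β) `[K:ℚ] ≤ 8`
∨ (γ) `[K:ℚ] = 16` with all squares in `{1, c}`)) ∨ (`m` prime ∧ `Gal(K/ℚ)` cyclic).  Here: **GOOD(K) ⟺ EVERY complex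
abelian variety `X` with `K ↪ End⁰(X)`, `[K:ℚ] = 2 dim X`, is STABLY NONDEGENERATE** — the simplicity hypothesis is
removed from the whole abelian chapter.  Mechanism: goodness is HEREDITARY to CM subfields of an abelian CM field
((α) passes to the quotient Galois group — `restrictNormalHom` maps `c` to `c` (`restrictNormalHom_complexConj`) and
does not increase the index of a cyclic subgroup; (β), (γ) leave subfields of degree `≤ 8`), and lit-hodgefound's
primitive core (`EndFieldFullDegree.exists_primitive_core`: `X ∼ B₁ʰ` for the simple variety of record `B₁` of the
primitive core `(K₁; Φ₁)` of THE type, `K₁ ≤ K` a CM subfield — abelian Galois by Mathlib's `IsAbelianGalois` instances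
down the tower) reduces to the simple case for `K₁`; the case `m` prime is `CyclicAllTypes` (gen 21 part IV).

* §1 `restrictNormalHom_complexConj` (`c|_E = c_E` for a Galois CM subfield `E`), **`alpha_restrict`** (heredity of (α)).
* §2 **`isStablyNondegenerate_of_good_two_power`** (`m = 1`), **`isStablyNondegenerate_of_good_abelian`** (all `m`).
* §3 **THE CLASSIFICATION `forall_isStablyNondegenerate_iff_abelian`** and the realisation form; HC corollaries.

## References

* [Shimura1998] G. Shimura, *Abelian Varieties with Complex Multiplication and Modular Functions* (1998), §5.1 Prop. 3,
  §8.2 Prop. 26.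
* [Gordon1999HodgeAVSurvey] B. B. Gordon, *A survey of the Hodge conjecture for abelian varieties*, Thm. 6.4, Def. 7.6,
  §9.4.3.
* [Kubota1965] T. Kubota, Trans. AMS 118 (1965), §4 Lemma 2.
* [Streng2010] M. Streng, *Complex multiplication of abelian surfaces* (2010), Ch. I Lemma 2.2 (d).
-/

noncomputable section

open CategoryTheory CategoryTheory.Limits NumberField

namespace Summit.HodgeConjecture.CorCM.AbelianAllTypes

open Literature.NumberTheory.ComplexMultiplication
open Literature.AlgebraicGeometry Literature.AlgebraicGeometry.Motives Literature.AlgebraicGeometry.HodgeTheory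
open Literature.AlgebraicGeometry.Motives.AbelianVariety
open Literature.AlgebraicGeometry.ComplexMultiplication
open Literature.AlgebraicGeometry.Pohlmann1968
open NumberField.ComplexEmbedding

/-! ## §1 Complex conjugation restricts to complex conjugation; heredity of (α) -/

section Restrict

variable {L : Type} [Field L] [NumberField L] [IsCMField L] [IsGalois ℚ L]

/-- **`c|_E = c_E`**: the restriction of the complex conjugation of a Galois CM field `L` to a normal CM subfield `E` is
the complex conjugation of `E` (both are the conjugation of any complex embedding of `E`; Mathlib `IsConj.ext`).
[cite: Streng2010, Ch. I Lemma 2.2 (d)] -/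
theorem restrictNormalHom_complexConj (E : IntermediateField ℚ L) [IsCMField E] [Normal ℚ E] :
    AlgEquiv.restrictNormalHom E ((IsCMField.complexConj L).restrictScalars ℚ) =
      (IsCMField.complexConj E).restrictScalars ℚ := by
  obtain ⟨ψ⟩ := (inferInstance : Nonempty (E →+* ℂ))
  have hres : AlgEquiv.restrictNormalHom E (conjGal : L ≃ₐ[ℚ] L) = conjGalRestrict E := by
    apply AlgEquiv.ext
    intro x
    apply Subtype.ext
    rw [coe_conjGalRestrict_apply]
    exact AlgEquiv.restrictNormal_commutes (conjGal : L ≃ₐ[ℚ] L) E x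
  have h1 : IsConj ψ (AlgEquiv.restrictNormalHom E ((IsCMField.complexConj L).restrictScalars ℚ)) := by
    rw [show (IsCMField.complexConj L).restrictScalars ℚ = (conjGal : L ≃ₐ[ℚ] L) from rfl, hres]
    exact isConj_conjGalRestrict E ψ
  have h2 : IsConj ψ ((IsCMField.complexConj E).restrictScalars ℚ) := by
    change conjugate ψ = ψ.comp _
    exact IsCMField.isConj_complexConj E ψ
  exact h1.ext h2

/-- **Heredity of (α)**: if complex conjugation of `L` lies in a cyclic subgroup `⟨z⟩` of index `≤ 2`, then complex
conjugation of a normal CM subfield `E` lies in `⟨z|_E⟩`, of index `≤ 2` (restriction is onto, so indices only drop).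
[cite: Gordon1999HodgeAVSurvey, §9.4.3] -/
theorem alpha_restrict (E : IntermediateField ℚ L) [IsCMField E] [Normal ℚ E]
    (h : ∃ z : L ≃ₐ[ℚ] L, (IsCMField.complexConj L).restrictScalars ℚ ∈ Subgroup.zpowers z ∧
      (Subgroup.zpowers z).index ≤ 2) :
    ∃ z : E ≃ₐ[ℚ] E, (IsCMField.complexConj E).restrictScalars ℚ ∈ Subgroup.zpowers z ∧
      (Subgroup.zpowers z).index ≤ 2 := by
  obtain ⟨z, hcz, hidx⟩ := h
  refine ⟨AlgEquiv.restrictNormalHom E z, ?_, ?_⟩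
  · rw [← restrictNormalHom_complexConj E, ← MonoidHom.map_zpowers]
    exact Subgroup.mem_map_of_mem _ hcz
  · have h1 : (Subgroup.zpowers (AlgEquiv.restrictNormalHom E z)).index ∣ (Subgroup.zpowers z).index := by
      rw [← MonoidHom.map_zpowers]
      exact Subgroup.index_map_dvd _ (AlgEquiv.restrictNormalHom_surjective L)
    exact le_trans (Nat.le_of_dvd (Nat.pos_of_ne_zero Subgroup.index_ne_zero_of_finite) h1) hidx

end Restrict

/-! ## §2 GOOD abelian CM fields: every abelian variety with a `K`-action is stably nondegenerate -/

section Field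

variable {K : Type} [Field K] [NumberField K] [IsCMField K] [IsGalois ℚ K]

omit [IsCMField K] [IsGalois ℚ K] in
/-- A power of `2` dividing properly into `2^{a}` is `≤ 2^{a-1}`; here in the form needed: `e ∣ 2^a`, `e < 2^a`,
`2^a ≤ 16` ⟹ `2e ≤ 16`, and `e ∣ 2^a` ⟹ `e` is a power of `2`. [folklore] -/
private theorem exists_pow_eq_of_dvd_two_pow {e a : ℕ} (h : e ∣ 2 ^ a) : ∃ b : ℕ, e = 2 ^ b := by
  obtain ⟨b, -, hb⟩ := (Nat.dvd_prime_pow Nat.prime_two).1 h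
  exact ⟨b, hb⟩

/-- **THEOREM (`m = 1`).  `K` abelian CM of degree `2^{a+1}` with (α) ∨ (β) ∨ (γ): EVERY complex abelian variety `X`
with `φ : K →+* End⁰(X)`, `[K:ℚ] = 2 dim X`, is stably nondegenerate.**  Simple `X`: THE type is primitive, gen 16.
Non-simple `X`: the primitive core `(K₁; Φ₁)`, `K₁ < K` an abelian CM subfield of degree `2^{b+1} < 2^{a+1}`, is GOOD by
heredity, so `Φ₁` is nondegenerate (gen 16) and `X ∼ B₁ʰ` is stably nondegenerate.
[cite: Gordon1999HodgeAVSurvey, Thm. 6.4 and §9.4.3] [cite: Shimura1998, §5.1 Prop. 3, §8.2 Prop. 26] -/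
theorem isStablyNondegenerate_of_good_two_power (hcomm : ∀ g h : K ≃ₐ[ℚ] K, g * h = h * g) {a : ℕ}
    (hK : Module.finrank ℚ K = 2 ^ (a + 1))
    (hgood : (∃ z : K ≃ₐ[ℚ] K, (IsCMField.complexConj K).restrictScalars ℚ ∈ Subgroup.zpowers z ∧
        (Subgroup.zpowers z).index ≤ 2) ∨ Module.finrank ℚ K ≤ 8 ∨
      (Module.finrank ℚ K = 16 ∧ ∀ g : K ≃ₐ[ℚ] K, g * g = 1 ∨ g * g = (IsCMField.complexConj K).restrictScalars ℚ))
    {X : AbelianVariety ℂ} (φ : K →+* X.endAlgebra) (hX : Module.finrank ℚ K = 2 * X.dim) :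
    IsStablyNondegenerate X := by
  classical
  by_cases hs : X.IsSimple
  · obtain ⟨φ₀⟩ := (inferInstance : Nonempty (K →+* ℂ))
    have hprim := (isPrimitive_ringEquiv_complex_iff _ φ₀).2
      ((EndFieldFullDegree.isSimple_iff_primitive_cmTypeOfPair φ hX).1 hs)
    exact EndFieldFullDegree.isStablyNondegenerate_of_isNondegenerate_cmTypeOfPair φ hX
      (AbelianTwoPowerClassification.isNondegenerate_of_isPrimitive_of_good hcomm hK hgood φ₀ hprim)
  · -- the abelian structure descends to all subfields
    haveI : IsMulCommutative (K ≃ₐ[ℚ] K) := ⟨⟨hcomm⟩⟩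
    haveI : IsAbelianGalois ℚ K := {}
    obtain ⟨K', hK', K₁, hK₁, Φ₁, hprim, hdim, hB₁, -, hS, hsimple⟩ := EndFieldFullDegree.exists_primitive_core φ hX
    haveI := hK'
    haveI := hK₁
    -- (the `IsAbelianGalois` instances for intermediate fields over `ℚ` are supplied by hand: the `Algebra ℚ _` paths
    -- of `IntermediateField` and `DivisionRing` differ reducibly)
    haveI hab' : IsAbelianGalois ℚ K' := IsAbelianGalois.tower_bot ℚ K' K
    haveI hab₁ : IsAbelianGalois ℚ K₁ := IsAbelianGalois.tower_bot ℚ K₁ K'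
    haveI : IsGalois ℚ K' := hab'.toIsGalois
    haveI : IsGalois ℚ K₁ := hab₁.toIsGalois
    haveI : Normal ℚ K' := IsGalois.to_normal
    haveI : Normal ℚ K₁ := IsGalois.to_normal
    apply hS
    set d : ℕ := (CMTorusRealisation.varietyOfIdeal Φ₁ 1).dim with hd_def
    -- degrees: `d ∣ dim X = 2^a`, `d < dim X`, `[K₁:ℚ] = 2d = 2^{b+1}`
    have hXd : X.dim = 2 ^ a := by
      have h := hX; rw [hK, pow_succ, mul_comm] at h; omega
    have hdvd : d ∣ X.dim := ⟨Module.finrank K' K * Module.finrank K₁ K', by rw [hdim]; ring⟩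
    have hlt : d < X.dim := lt_of_le_of_ne (Nat.le_of_dvd (by rw [hXd]; positivity) hdvd) fun h => hs (hsimple h.symm)
    obtain ⟨b, hb⟩ := exists_pow_eq_of_dvd_two_pow (hXd ▸ hdvd)
    have hK₁deg : Module.finrank ℚ K₁ = 2 ^ (b + 1) := by rw [← hB₁, hb, pow_succ, mul_comm]
    have hK₁lt : Module.finrank ℚ K₁ < Module.finrank ℚ K := by rw [← hB₁, hX]; omega
    -- `K₁` is an abelian Galois CM field
    have hcomm₁ : ∀ g h : (K₁ ≃ₐ[ℚ] K₁), g * h = h * g := fun g h => hab₁.toIsMulCommutative.is_comm.comm g h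
    obtain ⟨φ₁⟩ := (inferInstance : Nonempty (K₁ →+* ℂ))
    have hprim₁ := (isPrimitive_ringEquiv_complex_iff Φ₁ φ₁).2 hprim
    -- heredity of goodness
    have hgood₁ : (∃ z : K₁ ≃ₐ[ℚ] K₁, (IsCMField.complexConj K₁).restrictScalars ℚ ∈ Subgroup.zpowers z ∧
          (Subgroup.zpowers z).index ≤ 2) ∨ Module.finrank ℚ K₁ ≤ 8 ∨
        (Module.finrank ℚ K₁ = 16 ∧
          ∀ g : K₁ ≃ₐ[ℚ] K₁, g * g = 1 ∨ g * g = (IsCMField.complexConj K₁).restrictScalars ℚ) := by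
      rcases hgood with hα | hβ | ⟨h16, -⟩
      · exact Or.inl (alpha_restrict K₁ (alpha_restrict K' hα))
      · exact Or.inr (Or.inl (by omega))
      · refine Or.inr (Or.inl ?_)
        -- `2^{b+1} < 16` ⟹ `2^{b+1} ≤ 8`
        rw [hK₁deg]
        rw [hK₁deg, h16] at hK₁lt
        have hb3 : b + 1 < 4 := (Nat.pow_lt_pow_iff_right (by norm_num : 1 < 2)).1 (by simpa using hK₁lt)
        calc 2 ^ (b + 1) ≤ 2 ^ 3 := Nat.pow_le_pow_right (by norm_num) (by omega)
          _ = 8 := by norm_num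
    exact CMTorusRealisation.isStablyNondegenerate_varietyOfIdeal Φ₁ 1
      (AbelianTwoPowerClassification.isNondegenerate_of_isPrimitive_of_good hcomm₁ hK₁deg hgood₁ φ₁ hprim₁)

omit [IsGalois ℚ K] in
/-- An odd number is not `2`. [folklore] -/
private theorem ne_two_of_odd {m : ℕ} (hm : Odd m) : m ≠ 2 := by
  obtain ⟨j, rfl⟩ := hm
  omega

/-- **THEOREM (all `m`).  `K` abelian CM of degree `2^{a+1} m`, `m` odd, GOOD: EVERY complex abelian variety `X` with
`φ : K →+* End⁰(X)`, `[K:ℚ] = 2 dim X`, is stably nondegenerate** (`m = 1`: `isStablyNondegenerate_of_good_two_power`;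
`m` prime, `Gal` cyclic: gen 21 part IV `CyclicAllTypes.isStablyNondegenerate_of_ringHom_of_isCyclic`).
[cite: Gordon1999HodgeAVSurvey, Thm. 6.4 and §9.4] [cite: Shimura1998, §5.1 Prop. 3, §8.2 Prop. 26] -/
theorem isStablyNondegenerate_of_good_abelian (hcomm : ∀ g h : K ≃ₐ[ℚ] K, g * h = h * g) {a m : ℕ} (hm : Odd m)
    (hK : Module.finrank ℚ K = 2 ^ (a + 1) * m)
    (hgood : (m = 1 ∧ ((∃ z : K ≃ₐ[ℚ] K, (IsCMField.complexConj K).restrictScalars ℚ ∈ Subgroup.zpowers z ∧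
          (Subgroup.zpowers z).index ≤ 2) ∨ Module.finrank ℚ K ≤ 8 ∨
        (Module.finrank ℚ K = 16 ∧
          ∀ g : K ≃ₐ[ℚ] K, g * g = 1 ∨ g * g = (IsCMField.complexConj K).restrictScalars ℚ))) ∨
      (m.Prime ∧ IsCyclic (K ≃ₐ[ℚ] K)))
    {X : AbelianVariety ℂ} (φ : K →+* X.endAlgebra) (hX : Module.finrank ℚ K = 2 * X.dim) :
    IsStablyNondegenerate X := by
  rcases hgood with ⟨rfl, hgood⟩ | ⟨hp, hcyc⟩
  · exact isStablyNondegenerate_of_good_two_power hcomm (by rw [hK, mul_one]) hgood φ hX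
  · exact CyclicAllTypes.isStablyNondegenerate_of_ringHom_of_isCyclic hcyc hm (Or.inr hp) hK φ hX

/-- **The Hodge conjecture for everything isogenous to a power of such an `X`** (GOOD abelian CM field),
UNCONDITIONALLY. [cite: Gordon1999HodgeAVSurvey, Thm. 6.3–6.4] [cite: vanGeemen1994HodgeAV, Lemma 3.7] -/
theorem hodgeConjectureFor_of_isIsogenous_powSucc_of_good_abelian (hcomm : ∀ g h : K ≃ₐ[ℚ] K, g * h = h * g)
    {a m : ℕ} (hm : Odd m) (hK : Module.finrank ℚ K = 2 ^ (a + 1) * m)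
    (hgood : (m = 1 ∧ ((∃ z : K ≃ₐ[ℚ] K, (IsCMField.complexConj K).restrictScalars ℚ ∈ Subgroup.zpowers z ∧
          (Subgroup.zpowers z).index ≤ 2) ∨ Module.finrank ℚ K ≤ 8 ∨
        (Module.finrank ℚ K = 16 ∧
          ∀ g : K ≃ₐ[ℚ] K, g * g = 1 ∨ g * g = (IsCMField.complexConj K).restrictScalars ℚ))) ∨
      (m.Prime ∧ IsCyclic (K ≃ₐ[ℚ] K)))
    {X : AbelianVariety ℂ} (φ : K →+* X.endAlgebra) (hX : Module.finrank ℚ K = 2 * X.dim) {B : AbelianVariety ℂ}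
    {N : ℕ} (h : IsIsogenous B (X.powSucc N)) : HodgeConjectureFor B.dim B.X :=
  (isStablyNondegenerate_of_good_abelian hcomm hm hK hgood φ hX).hodgeConjectureFor_of_isIsogenous_powSucc h

variable {Φ : CMType K} {A : AbelianVariety ℂ} {ι : 𝓞 K →+* End A} {θ : K →+* Module.End ℂ (complexBetti A.X 1)}

/-- **Realisation form**: every abelian variety `(A, ι)` of ANY CM type of a GOOD abelian CM field is stably
nondegenerate; in particular the Hodge conjecture holds for every power `⨁_{Fin N} A` (gens 16/18's
`hodgeConjectureFor_pow_of_isSimple_of_good` without `A.IsSimple`). [cite: Gordon1999HodgeAVSurvey, Thm. 6.4 and §9.4] -/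
theorem hodgeConjectureFor_pow_of_good_abelian (hcomm : ∀ g h : K ≃ₐ[ℚ] K, g * h = h * g) {a m : ℕ} (hm : Odd m)
    (hK : Module.finrank ℚ K = 2 ^ (a + 1) * m)
    (hgood : (m = 1 ∧ ((∃ z : K ≃ₐ[ℚ] K, (IsCMField.complexConj K).restrictScalars ℚ ∈ Subgroup.zpowers z ∧
          (Subgroup.zpowers z).index ≤ 2) ∨ Module.finrank ℚ K ≤ 8 ∨
        (Module.finrank ℚ K = 16 ∧
          ∀ g : K ≃ₐ[ℚ] K, g * g = 1 ∨ g * g = (IsCMField.complexConj K).restrictScalars ℚ))) ∨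
      (m.Prime ∧ IsCyclic (K ≃ₐ[ℚ] K)))
    (hA : IsCMTypeRealisation Φ A ι θ) (N : ℕ) :
    HodgeConjectureFor (⨁ fun _ : Fin N => A).dim (⨁ fun _ : Fin N => A).X := by
  obtain ⟨i, -⟩ := exists_ringHom_endAlgebra ι
  exact hodgeConjectureFor_of_isDivisorGenerated _
    ((isStablyNondegenerate_iff_forall_isDivisorGenerated_biproduct A).1
      (isStablyNondegenerate_of_good_abelian hcomm hm hK hgood i (finrank_eq_two_mul_dim_of_isCMTypeRealisation hA)) N)

/-! ## §3 The classification for abelian CM fields, all abelian varieties -/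

/-- **THE CLASSIFICATION (abelian CM fields, all abelian varieties).**  `K` abelian CM of degree `2^{a+1} m`, `m` odd:
EVERY complex abelian variety `X` with `K ↪ End⁰(X)`, `[K:ℚ] = 2 dim X`, is stably nondegenerate ⟺ GOOD(K) — the
same condition as for SIMPLE varieties (gen 18 `forall_isSimple_isNondegenerate_iff_abelian`): goodness is hereditary
to the CM subfields of an abelian CM field.  (⇒: a primitive degenerate type of a bad `K`, realised — tree
`cmAbelianVarietyRealised_holds` — by a variety that is not stably nondegenerate, Hazama's criterion.)
[cite: Gordon1999HodgeAVSurvey, Thm. 6.4 and §9.4.3] [cite: Shimura1998, §6.2 Thm. 3, §8.2 Prop. 26] -/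
theorem forall_isStablyNondegenerate_iff_abelian (hcomm : ∀ g h : K ≃ₐ[ℚ] K, g * h = h * g) {a m : ℕ} (hm : Odd m)
    (hK : Module.finrank ℚ K = 2 ^ (a + 1) * m) :
    (∀ (X : AbelianVariety ℂ) (_ : K →+* X.endAlgebra), Module.finrank ℚ K = 2 * X.dim → IsStablyNondegenerate X) ↔
      ((m = 1 ∧ ((∃ z : K ≃ₐ[ℚ] K, (IsCMField.complexConj K).restrictScalars ℚ ∈ Subgroup.zpowers z ∧
          (Subgroup.zpowers z).index ≤ 2) ∨ Module.finrank ℚ K ≤ 8 ∨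
        (Module.finrank ℚ K = 16 ∧
          ∀ g : K ≃ₐ[ℚ] K, g * g = 1 ∨ g * g = (IsCMField.complexConj K).restrictScalars ℚ))) ∨
      (m.Prime ∧ IsCyclic (K ≃ₐ[ℚ] K))) := by
  refine ⟨fun h => ?_, fun hgood X φ hX => isStablyNondegenerate_of_good_abelian hcomm hm hK hgood φ hX⟩
  obtain ⟨φ₀⟩ := (inferInstance : Nonempty (K →+* ℂ))
  rw [← AbelianOddPart.forall_isPrimitive_isNondegenerate_iff_abelian hcomm hm hK φ₀]
  intro Ψ hprim
  obtain ⟨B, ιB, θB, hB⟩ := exists_isCMTypeRealisation_of_realised cmAbelianVarietyRealised_holds K Ψ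
  obtain ⟨i, -⟩ := exists_ringHom_endAlgebra ιB
  exact (isStablyNondegenerate_iff_isNondegenerate φ₀ hprim hB).1
    (h B i (finrank_eq_two_mul_dim_of_isCMTypeRealisation hB))

/-- **The same in the realisation vocabulary**: every abelian variety `(A, ι)` of ANY CM type `(K; Φ)` is stably
nondegenerate ⟺ GOOD(K). [cite: Gordon1999HodgeAVSurvey, Thm. 6.4] [cite: Shimura1998, §8.2 Prop. 26] -/
theorem forall_realisation_isStablyNondegenerate_iff_abelian (hcomm : ∀ g h : K ≃ₐ[ℚ] K, g * h = h * g) {a m : ℕ}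
    (hm : Odd m) (hK : Module.finrank ℚ K = 2 ^ (a + 1) * m) :
    (∀ (Φ : CMType K) (A : AbelianVariety ℂ) (ι : 𝓞 K →+* End A) (θ : K →+* Module.End ℂ (complexBetti A.X 1)),
        IsCMTypeRealisation Φ A ι θ → IsStablyNondegenerate A) ↔
      ((m = 1 ∧ ((∃ z : K ≃ₐ[ℚ] K, (IsCMField.complexConj K).restrictScalars ℚ ∈ Subgroup.zpowers z ∧
          (Subgroup.zpowers z).index ≤ 2) ∨ Module.finrank ℚ K ≤ 8 ∨
        (Module.finrank ℚ K = 16 ∧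
          ∀ g : K ≃ₐ[ℚ] K, g * g = 1 ∨ g * g = (IsCMField.complexConj K).restrictScalars ℚ))) ∨
      (m.Prime ∧ IsCyclic (K ≃ₐ[ℚ] K))) := by
  rw [← forall_isStablyNondegenerate_iff_abelian hcomm hm hK]
  constructor
  · intro h X i hX
    -- THE type of `(X, i)` is realised by Shimura's principal model `X' ∼ X`
    obtain ⟨X', φ', ι', hφι, f, hf⟩ := exists_principal_pair i
    have hdim' : Module.finrank ℚ K = 2 * X'.dim := by rw [← dim_eq_of_isIsogeny hf, hX]
    exact (h _ X' ι' _ (isCMTypeRealisation_cmTypeOfPair φ' hdim' ι' hφι)).of_isIsogenous ⟨f, hf⟩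
  · intro h Φ A ι θ hA
    obtain ⟨i, -⟩ := exists_ringHom_endAlgebra ι
    exact h A i (finrank_eq_two_mul_dim_of_isCMTypeRealisation hA)

end Field

end Summit.HodgeConjecture.CorCM.AbelianAllTypes

end
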